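import Summits.CriticalPhenomena.PercolationContinuityZ3.Theorems.PercNearOneGluingNoHeavyQuantSDEC
import HarnessLib

/-!
# QUANT lane R8, the gated heavy node: ATTACHING A GATED RELAY IS A THEOREM — every two-layer row of
# `gate (lconv μ₁ ρ) q` for a relay-type second factor `ρ` on `{0,1}` (the case `M₂ = 1` of `TLBGateConvClosedHeavy`),
# from TWO gated reflections of `μ₁` and the heaviness `ρ(1) ≥ 1/2`, with a two-term tilt-free certificate

builds on p205010 (kernel theorem, internal audit signed; external expert review pending)

Support file (`--supports stmt-CriticalPhenomena-4575`), QUANT lane LEAD seat prim-quant-lead (gen 38); lane finding V370 (`README.md`),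
memo `run/shared/lean/prim/quant/prim-quant-lead-g38/PHANTOM-G38.md` §9.  Theorems only, standard axioms, no sorries; imports only
`…QuantSDEC` (census-2 g53: `gate`, `lconv`, `sum_lconv`).  Companion of `…QuantPhantomRowZero` (the `d = 0` row, this seat).

THE STATEMENT (rows `d ≥ 1`).  Floor `y` with `1/2 ≤ y < 1` is NOT needed as such — what is needed is that the relay is HEAVY: a law `ρ`
on `{0,1}` with `p := ρ(1) ≥ 1/2` and `p ≥ y` (in the node's binder both follow from top-affordability `y·1 ≤ q·p` and `y ≥ 1/2`), a gate
`0 ≤ q ≤ 1`, and a nonnegative law `μ₁` of mass `1` on `{0..M₁}` with mean `T₁` whose gated version satisfies the two-layer rows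
(`…QuantTLBClosure`'s `TLB (y/(1−y)) (qT₁) M₁ (gate μ₁ q)`, written here UNFOLDED and in the `(1−y)`-scaled functional form
`0 ≤ Σ_a μ₁(a)·H_c(a)`, `H_c(a) = (1−y)q·[qT₁ − c ≤ a] − yq·[a ≤ c] − y(1−q)`) at the two levels `c ∈ {ℓ, ℓ′}` below.  CONCLUSION: the
row `d` of the gated convolution, `0 ≤ Σ_h lconv(h)·K_d(h)` with `K_d(n) = (1−y)q·[q(T₁+p) − d ≤ n] − yq·[n ≤ d] − y(1−q)`, equivalently
`(y/(1−y))·Σ_{h ≤ d} ν h ≤ Σ_{h, q(T₁+p) − d ≤ h} ν h` for `ν = gate (lconv M₁ 1 μ₁ ρ) q` (`tlb_gateConv_relay_row`).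

THE CERTIFICATE (no tilts, no mean of `μ₁`, no top-affordability of `μ₁`).  With `t₁ = qT₁`, `t = t₁ + qp` (`0 ≤ qp ≤ 1`):
`(1−p)·K_d(a) + p·K_d(a+1) ≥ (1−p)·H_d(a) + p·H_{d−1}(a)` if `2d < t₁`, and `≥ H_{d−1}(a)` if `2d ≥ t₁` (then `2(d−1) < t₁`), for every `a`.
Proof: the constants `−y(1−q)` cancel; the low parts agree (`[a+1 ≤ d] = [a ≤ d−1]`), except the single cell `a = d` in the capped case,
which costs `yq(1−p)` and is repaid by the claim `p·(1−y)q·[t − d ≤ d+1]` (valid as `2d ≥ t₁ ≥ t − 1`) because `p ≥ y`; the claims of `H_d`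
on the window `t₁ − d ≤ a < t − d` (width `qp ≤ 1`) exceed `K_d`'s by `(1−p)` and are repaid at the same `a` by `p·[t − d ≤ a + 1]`, because
`p ≥ 1/2` (this is where HEAVINESS enters; for `p < 1/2` the statement is false — the light-half witnesses of `not_tlbGateConvClosed` are
relay ⊗ blob).  Integrating against `μ₁(a) ≥ 0` and using `Σ_h φ(h)·lconv M₁ 1 μ₁ ρ(h) = Σ_a μ₁(a)((1−p)φ(a) + pφ(a+1))` gives the row.
Exact numerics (lane explore/m2one.py): the pointwise inequality holds on 20 000 / 20 000 adversarial instances (it is a theorem; the run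
found the certificate).  In the tree language: under the heavy floor, convolving ANY admissible subtree law with a gated relay (attaching
a leaf behind an edge) preserves the gated two-layer family — the `M₂ = 1` slice of the node, which is exactly where the lane's LP
censuses needed the `S*`-rows (V369).

* `LawDec.sum_fun_mul_lconv_one` — bookkeeping: a test function against `lconv M₁ 1 μ₁ ρ`.
* `LawDec.leaf_pointwise_uncapped`, `LawDec.leaf_pointwise_capped` — the certificate inequalities.
* `LawDec.lconv_relay_row_functional` — the row in functional form from the two functional hypotheses.
* `LawDec.tlb_gateConv_relay_row` — the row in the `TLB` shape (hypotheses = the two `TLB` rows of `gate μ₁ q`, unfolded).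

HONEST STATUS: the `M₂ = 1` slice (all rows `d ≥ 1`; `d = 0` is `…QuantPhantomRowZero`) of an OPEN node (`TLBGateConvClosedHeavy`,
general `M₂` open for `q < 1`); `FarTreeRowHeavy` / `FarTreeRow` OPEN; nothing here is a published result; the RATE class log\* and the
honest sentence of `run/shared/lean/prim/quant/README.md` are unchanged.

[this work].  The gluing rows served [cite: KozmaNitzan2024, Conjecture 3 (p. 15)]; product measure [cite: Grimmett1999, §1.3 p. 10].
-/

noncomputable section

namespace Summit.CriticalPhenomena.PercolationContinuityZ3.Theorems

namespace Quant

open Finset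

namespace LawDec

/-- bookkeeping: a test function against the convolution with a law on `{0,1}`:
`Σ_{h ≤ M₁+1} φ h · lconv M₁ 1 μ₁ ρ h = Σ_{a ≤ M₁} μ₁ a · (ρ 0 · φ a + ρ 1 · φ (a+1))`. [this work] -/
theorem sum_fun_mul_lconv_one (M₁ : ℕ) (μ₁ ρ : ℕ → ℝ) (φ : ℕ → ℝ) :
    ∑ h ∈ Finset.range (M₁ + 1 + 1), φ h * lconv M₁ 1 μ₁ ρ h
      = ∑ a ∈ Finset.range (M₁ + 1), μ₁ a * (ρ 0 * φ a + ρ 1 * φ (a + 1)) := by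
  simp only [lconv, Finset.mul_sum]
  rw [Finset.sum_comm]
  refine Finset.sum_congr rfl fun a ha => ?_
  rw [Finset.mem_range] at ha
  rw [Finset.sum_comm, Finset.sum_range_succ, Finset.sum_range_one]
  have e0 : ∑ h ∈ Finset.range (M₁ + 1 + 1), φ h * (if a + 0 = h then μ₁ a * ρ 0 else 0) = φ a * (μ₁ a * ρ 0) := by
    have : ∀ h : ℕ, φ h * (if a + 0 = h then μ₁ a * ρ 0 else 0) = if a + 0 = h then φ (a + 0) * (μ₁ a * ρ 0) else 0 := by
      intro h; split_ifs with hh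
      · rw [hh]
      · rw [mul_zero]
    simp_rw [this]
    rw [Finset.sum_ite_eq (Finset.range (M₁ + 1 + 1)) (a + 0), if_pos (Finset.mem_range.2 (by omega)), add_zero]
  have e1 : ∑ h ∈ Finset.range (M₁ + 1 + 1), φ h * (if a + 1 = h then μ₁ a * ρ 1 else 0) = φ (a + 1) * (μ₁ a * ρ 1) := by
    have : ∀ h : ℕ, φ h * (if a + 1 = h then μ₁ a * ρ 1 else 0) = if a + 1 = h then φ (a + 1) * (μ₁ a * ρ 1) else 0 := by
      intro h; split_ifs with hh
      · rw [hh]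
      · rw [mul_zero]
    simp_rw [this]
    rw [Finset.sum_ite_eq (Finset.range (M₁ + 1 + 1)) (a + 1), if_pos (Finset.mem_range.2 (by omega))]
  rw [e0, e1]
  ring

/-- **the certificate, uncapped case `2d < t₁`** (all reals; `a` any integer point): with `y ≤ 1`, `0 ≤ q`, `q·p ≤ 1`, `1/2 ≤ p`,
`1 ≤ d`:  `(1−p)K_d(a) + pK_d(a+1) ≥ (1−p)H_d(a) + pH_{d−1}(a)` where
`K_d(n) = (1−y)q[t₁ + qp − d ≤ n] − yq[n ≤ d] − y(1−q)` and `H_c(a) = (1−y)q[t₁ − c ≤ a] − yq[a ≤ c] − y(1−q)`. [this work] -/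
theorem leaf_pointwise_uncapped (y q t₁ p : ℝ) (d a : ℕ) (hy1 : y ≤ 1) (hq0 : 0 ≤ q) (hqp : q * p ≤ 1)
    (hp : 1 / 2 ≤ p) (hd : 1 ≤ d) :
    (1 - p) * ((1 - y) * q * (if t₁ - d ≤ (a : ℝ) then (1 : ℝ) else 0) - y * q * (if a ≤ d then (1 : ℝ) else 0) - y * (1 - q))
      + p * ((1 - y) * q * (if t₁ - ((d - 1 : ℕ) : ℝ) ≤ (a : ℝ) then (1 : ℝ) else 0) - y * q * (if a ≤ d - 1 then (1 : ℝ) else 0)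
          - y * (1 - q))
    ≤ (1 - p) * ((1 - y) * q * (if t₁ + q * p - d ≤ (a : ℝ) then (1 : ℝ) else 0) - y * q * (if a ≤ d then (1 : ℝ) else 0) - y * (1 - q))
      + p * ((1 - y) * q * (if t₁ + q * p - d ≤ ((a + 1 : ℕ) : ℝ) then (1 : ℝ) else 0) - y * q * (if a + 1 ≤ d then (1 : ℝ) else 0)
          - y * (1 - q)) := by
  have hd1 : ((d - 1 : ℕ) : ℝ) = (d : ℝ) - 1 := by rw [Nat.cast_sub hd, Nat.cast_one]
  rw [hd1]
  have hlow : (if a ≤ d - 1 then (1 : ℝ) else 0) = (if a + 1 ≤ d then (1 : ℝ) else 0) := by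
    by_cases h : a ≤ d - 1
    · rw [if_pos h, if_pos (by omega)]
    · rw [if_neg h, if_neg (by omega)]
  rw [hlow]
  have hyq : 0 ≤ (1 - y) * q := mul_nonneg (by linarith) hq0
  push_cast
  -- the four claim indicators, `m := a − (t₁ − d)`: A₀ = [m ≥ 0], B₀ = [m ≥ 1], A₁ = [m ≥ qp], B₁ = [m ≥ qp − 1]
  by_cases hA0 : t₁ - d ≤ (a : ℝ) <;> by_cases hB0 : t₁ - ((d : ℝ) - 1) ≤ (a : ℝ) <;>
    by_cases hA1 : t₁ + q * p - d ≤ (a : ℝ) <;> by_cases hB1 : t₁ + q * p - d ≤ (a : ℝ) + 1 <;>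
    simp only [hA0, hB0, hA1, hB1, if_true, if_false] <;>
    nlinarith [mul_nonneg hyq (by linarith : (0 : ℝ) ≤ 2 * p - 1), mul_nonneg hyq (by linarith : (0 : ℝ) ≤ p)]

/-- **the certificate, capped case `t₁ ≤ 2d`** (then the level used is `d − 1` with full weight): with `0 ≤ y ≤ 1`, `0 ≤ q`,
`q·p ≤ 1`, `y ≤ p`, `1 ≤ d`, `2d < t₁ + qp`:  `(1−p)K_d(a) + pK_d(a+1) ≥ H_{d−1}(a)`. [this work] -/
theorem leaf_pointwise_capped (y q t₁ p : ℝ) (d a : ℕ) (hy0 : 0 ≤ y) (hy1 : y ≤ 1) (hq0 : 0 ≤ q) (hqp : q * p ≤ 1)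
    (hyp : y ≤ p) (hd : 1 ≤ d) (hcap : t₁ ≤ 2 * (d : ℝ)) (hdt : 2 * (d : ℝ) < t₁ + q * p) :
    ((1 - y) * q * (if t₁ - ((d - 1 : ℕ) : ℝ) ≤ (a : ℝ) then (1 : ℝ) else 0) - y * q * (if a ≤ d - 1 then (1 : ℝ) else 0) - y * (1 - q))
    ≤ (1 - p) * ((1 - y) * q * (if t₁ + q * p - d ≤ (a : ℝ) then (1 : ℝ) else 0) - y * q * (if a ≤ d then (1 : ℝ) else 0) - y * (1 - q))
      + p * ((1 - y) * q * (if t₁ + q * p - d ≤ ((a + 1 : ℕ) : ℝ) then (1 : ℝ) else 0) - y * q * (if a + 1 ≤ d then (1 : ℝ) else 0)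
          - y * (1 - q)) := by
  have hd1 : ((d - 1 : ℕ) : ℝ) = (d : ℝ) - 1 := by rw [Nat.cast_sub hd, Nat.cast_one]
  rw [hd1]
  have hlow : (if a ≤ d - 1 then (1 : ℝ) else 0) = (if a + 1 ≤ d then (1 : ℝ) else 0) := by
    by_cases h : a ≤ d - 1
    · rw [if_pos h, if_pos (by omega)]
    · rw [if_neg h, if_neg (by omega)]
  rw [hlow]
  have hyq : 0 ≤ (1 - y) * q := mul_nonneg (by linarith) hq0
  have hyq' : 0 ≤ y * q := mul_nonneg hy0 hq0
  push_cast
  by_cases had : a = d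
  · -- the one cell where the low parts differ: costs `yq(1−p)`, repaid by the claim `p(1−y)q·[t − d ≤ d + 1]` since `p ≥ y`
    subst had
    have h1 : ¬ (a + 1 ≤ a) := by omega
    have h2 : a ≤ a := le_rfl
    have hc1 : ¬ (t₁ + q * p - (a : ℝ) ≤ (a : ℝ)) := by intro h; linarith
    have hc2 : t₁ + q * p - (a : ℝ) ≤ (a : ℝ) + 1 := by linarith
    have hc3 : ¬ (t₁ - ((a : ℝ) - 1) ≤ (a : ℝ)) := by intro h; linarith
    simp only [h1, h2, hc1, hc2, hc3, if_true, if_false]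
    nlinarith [mul_nonneg hq0 (by linarith : (0 : ℝ) ≤ p - y)]
  · have hlow2 : (if a ≤ d then (1 : ℝ) else 0) = (if a + 1 ≤ d then (1 : ℝ) else 0) := by
      by_cases h : a ≤ d
      · rw [if_pos h, if_pos (by omega)]
      · rw [if_neg h, if_neg (by omega)]
    rw [hlow2]
    by_cases hB0 : t₁ - ((d : ℝ) - 1) ≤ (a : ℝ) <;> by_cases hA1 : t₁ + q * p - d ≤ (a : ℝ) <;>
      by_cases hB1 : t₁ + q * p - d ≤ (a : ℝ) + 1 <;> by_cases hL : a + 1 ≤ d <;>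
      simp only [hB0, hA1, hB1, hL, if_true, if_false] <;>
      nlinarith [mul_nonneg hyq (by linarith : (0 : ℝ) ≤ p), mul_nonneg hyq' (by linarith : (0 : ℝ) ≤ p)]

/-- sums of a function vanishing above `N`: `Σ_{h ≤ d} f h = Σ_{h ≤ N} [h ≤ d]·f h`. [this work] -/
theorem sum_range_eq_sum_ite_of_vanish (f : ℕ → ℝ) (N d : ℕ) (hf : ∀ h, N < h → f h = 0) :
    ∑ h ∈ Finset.range (d + 1), f h = ∑ h ∈ Finset.range (N + 1), (if h ≤ d then f h else 0) := by
  rcases le_or_gt d N with hdN | hNd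
  · rw [← Finset.sum_range_add_sum_Ico _ (show d + 1 ≤ N + 1 by omega)]
    have h1 : ∑ h ∈ Finset.range (d + 1), (if h ≤ d then f h else 0) = ∑ h ∈ Finset.range (d + 1), f h :=
      Finset.sum_congr rfl fun h hh => by rw [Finset.mem_range] at hh; rw [if_pos (by omega)]
    have h2 : ∑ h ∈ Finset.Ico (d + 1) (N + 1), (if h ≤ d then f h else 0) = 0 :=
      Finset.sum_eq_zero fun h hh => by rw [Finset.mem_Ico] at hh; rw [if_neg (by omega)]
    rw [h1, h2, add_zero]
  · rw [← Finset.sum_range_add_sum_Ico f (show N + 1 ≤ d + 1 by omega)]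
    have h1 : ∑ h ∈ Finset.range (N + 1), (if h ≤ d then f h else 0) = ∑ h ∈ Finset.range (N + 1), f h :=
      Finset.sum_congr rfl fun h hh => by rw [Finset.mem_range] at hh; rw [if_pos (by omega)]
    have h2 : ∑ h ∈ Finset.Ico (N + 1) (d + 1), f h = 0 :=
      Finset.sum_eq_zero fun h hh => by rw [Finset.mem_Ico] at hh; exact hf h (by omega)
    rw [h1, h2, add_zero]

/-- an `ite`-restricted sum of a gated law in terms of the ungated law:
`Σ_{h ≤ M} [P h]·gate μ q h = q·Σ_{h ≤ M} [P h]·μ h + (1−q)·[P 0]`. [this work] -/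
theorem sum_ite_gate (M : ℕ) (μ : ℕ → ℝ) (q : ℝ) (P : ℕ → Prop) [DecidablePred P] :
    ∑ h ∈ Finset.range (M + 1), (if P h then gate μ q h else 0)
      = q * ∑ h ∈ Finset.range (M + 1), (if P h then μ h else 0) + (1 - q) * (if P 0 then (1 : ℝ) else 0) := by
  have e : ∀ h : ℕ, (if P h then gate μ q h else 0)
      = q * (if P h then μ h else 0) + (if h = 0 then (1 - q) * (if P 0 then (1 : ℝ) else 0) else 0) := by
    intro h
    by_cases hP : P h
    · by_cases h0 : h = 0
      · subst h0; simp [gate, hP]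
      · simp [gate, hP, h0]
    · by_cases h0 : h = 0
      · subst h0; simp [hP]
      · simp [hP, h0]
  simp_rw [e]
  rw [Finset.sum_add_distrib, ← Finset.mul_sum, Finset.sum_ite_eq' (Finset.range (M + 1)) 0,
    if_pos (Finset.mem_range.2 (Nat.succ_pos M))]

/-- bookkeeping: `Σ μ a · (c · [P a]) = c · Σ [P a]·μ a`. [this work] -/
theorem sum_mul_weighted_ite (s : Finset ℕ) (μ : ℕ → ℝ) (c : ℝ) (P : ℕ → Prop) [DecidablePred P] :
    ∑ a ∈ s, μ a * (c * (if P a then (1 : ℝ) else 0)) = c * ∑ a ∈ s, (if P a then μ a else 0) := by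
  rw [Finset.mul_sum]
  exact Finset.sum_congr rfl fun a _ => by split_ifs <;> ring

/-- **THE RELAY ROW IN FUNCTIONAL FORM.**  `0 ≤ y ≤ 1`, `0 ≤ q`; `μ₁ ≥ 0` on `{0..M₁}`; a law `ρ` on `{0,1}` entering only through
`p := ρ 1` and `ρ 0 = 1 − p`, with `q·p ≤ 1`, `1/2 ≤ p ≤ 1`, `y ≤ p`; a target `t₁` (any real) at which `μ₁` satisfies the functional
rows `0 ≤ Σ_a μ₁(a)·H_c(a)` for every `c` with `2c < t₁`; a level `d ≥ 1` with `2d < t₁ + qp`.  Then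
`0 ≤ Σ_h lconv M₁ 1 μ₁ ρ (h) · K_d(h)`, `K_d(n) = (1−y)q[t₁ + qp − d ≤ n] − yq[n ≤ d] − y(1−q)`. [this work] -/
theorem lconv_relay_row_functional (y q t₁ : ℝ) (M₁ : ℕ) (μ₁ ρ : ℕ → ℝ) (d : ℕ)
    (hy0 : 0 ≤ y) (hy1 : y ≤ 1) (hq0 : 0 ≤ q) (h10 : ∀ h, 0 ≤ μ₁ h) (hρ0 : ρ 0 = 1 - ρ 1)
    (hqp : q * ρ 1 ≤ 1) (hp : 1 / 2 ≤ ρ 1) (hp1 : ρ 1 ≤ 1) (hyp : y ≤ ρ 1)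
    (hrows : ∀ c : ℕ, 2 * (c : ℝ) < t₁ → 0 ≤ ∑ a ∈ Finset.range (M₁ + 1), μ₁ a *
      ((1 - y) * q * (if t₁ - c ≤ (a : ℝ) then (1 : ℝ) else 0) - y * q * (if a ≤ c then (1 : ℝ) else 0) - y * (1 - q)))
    (hd : 1 ≤ d) (hdt : 2 * (d : ℝ) < t₁ + q * ρ 1) :
    0 ≤ ∑ h ∈ Finset.range (M₁ + 1 + 1), lconv M₁ 1 μ₁ ρ h *
      ((1 - y) * q * (if t₁ + q * ρ 1 - d ≤ (h : ℝ) then (1 : ℝ) else 0) - y * q * (if h ≤ d then (1 : ℝ) else 0) - y * (1 - q)) := by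
  set p : ℝ := ρ 1 with hp_def
  set K : ℕ → ℝ := fun n =>
    (1 - y) * q * (if t₁ + q * p - d ≤ (n : ℝ) then (1 : ℝ) else 0) - y * q * (if n ≤ d then (1 : ℝ) else 0) - y * (1 - q) with hK
  set H : ℕ → ℕ → ℝ := fun c a =>
    (1 - y) * q * (if t₁ - c ≤ (a : ℝ) then (1 : ℝ) else 0) - y * q * (if a ≤ c then (1 : ℝ) else 0) - y * (1 - q) with hH
  -- the goal in `μ₁`-form
  have hconv : ∑ h ∈ Finset.range (M₁ + 1 + 1), lconv M₁ 1 μ₁ ρ h * K h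
      = ∑ a ∈ Finset.range (M₁ + 1), μ₁ a * ((1 - p) * K a + p * K (a + 1)) := by
    have := sum_fun_mul_lconv_one M₁ μ₁ ρ K
    rw [hρ0] at this
    rw [← hp_def] at this
    calc ∑ h ∈ Finset.range (M₁ + 1 + 1), lconv M₁ 1 μ₁ ρ h * K h
        = ∑ h ∈ Finset.range (M₁ + 1 + 1), K h * lconv M₁ 1 μ₁ ρ h := Finset.sum_congr rfl fun h _ => mul_comm _ _
      _ = ∑ a ∈ Finset.range (M₁ + 1), μ₁ a * ((1 - p) * K a + p * K (a + 1)) := this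
  show 0 ≤ ∑ h ∈ Finset.range (M₁ + 1 + 1), lconv M₁ 1 μ₁ ρ h * K h
  rw [hconv]
  by_cases hcap : 2 * (d : ℝ) < t₁
  · -- uncapped: certificate `(1−p)·H_d + p·H_{d−1}`
    have hv1 : 2 * ((d - 1 : ℕ) : ℝ) < t₁ := by
      rw [Nat.cast_sub hd, Nat.cast_one]; linarith
    have hc := hrows d hcap
    have hc' := hrows (d - 1) hv1
    have hpt : ∀ a ∈ Finset.range (M₁ + 1), μ₁ a * ((1 - p) * H d a + p * H (d - 1) a) ≤ μ₁ a * ((1 - p) * K a + p * K (a + 1)) :=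
      fun a _ => mul_le_mul_of_nonneg_left (leaf_pointwise_uncapped y q t₁ p d a hy1 hq0 hqp hp hd) (h10 a)
    calc (0 : ℝ) ≤ (1 - p) * ∑ a ∈ Finset.range (M₁ + 1), μ₁ a * H d a + p * ∑ a ∈ Finset.range (M₁ + 1), μ₁ a * H (d - 1) a :=
          add_nonneg (mul_nonneg (by linarith) hc) (mul_nonneg (by linarith) hc')
      _ = ∑ a ∈ Finset.range (M₁ + 1), μ₁ a * ((1 - p) * H d a + p * H (d - 1) a) := by
          rw [Finset.mul_sum, Finset.mul_sum, ← Finset.sum_add_distrib]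
          exact Finset.sum_congr rfl fun a _ => by ring
      _ ≤ ∑ a ∈ Finset.range (M₁ + 1), μ₁ a * ((1 - p) * K a + p * K (a + 1)) := Finset.sum_le_sum hpt
  · -- capped: certificate `H_{d−1}` with full weight
    have hcap' : t₁ ≤ 2 * (d : ℝ) := not_lt.1 hcap
    have hv1 : 2 * ((d - 1 : ℕ) : ℝ) < t₁ := by
      rw [Nat.cast_sub hd, Nat.cast_one]
      have : q * p ≤ 1 := hqp
      linarith
    have hc' := hrows (d - 1) hv1
    have hpt : ∀ a ∈ Finset.range (M₁ + 1), μ₁ a * H (d - 1) a ≤ μ₁ a * ((1 - p) * K a + p * K (a + 1)) :=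
      fun a _ => mul_le_mul_of_nonneg_left (leaf_pointwise_capped y q t₁ p d a hy0 hy1 hq0 hqp hyp hd hcap' hdt) (h10 a)
    exact le_trans hc' (Finset.sum_le_sum hpt)

/-- **ATTACHING A GATED RELAY PRESERVES THE GATED TWO-LAYER ROWS** (the `M₂ = 1` slice of `TLBGateConvClosedHeavy`, rows `d ≥ 1`; shape
of `…QuantTLBClosure`'s `TLB`, unfolded).  `1/2 ≤ y < 1`, `0 < q ≤ 1`; `μ₁` a nonnegative law of mass `1` on `{0..M₁}` (vanishing above
`M₁`, mean `T₁`) whose gated version satisfies the rows `u·Σ_{h ≤ c} gate μ₁ q h ≤ Σ_{h ≤ M₁, qT₁ − c ≤ h} gate μ₁ q h` (`2c < qT₁`,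
`u = y/(1−y)`); `ρ` a nonnegative law of mass `1` on `{0,1}` (mean `T₂ = ρ 1`) whose gated version is top-affordable (`y·1 ≤ q·T₂`).  Then
for every `d ≥ 1` with `2d < q(T₁+T₂)`:  `u·Σ_{h ≤ d} ν h ≤ Σ_{h ≤ M₁+1, q(T₁+T₂) − d ≤ h} ν h`, `ν = gate (lconv M₁ 1 μ₁ ρ) q`.  (Row
`d = 0`: `…QuantPhantomRowZero`.)  No mean or top-affordability hypothesis on `μ₁` is used. [this work] -/
theorem tlb_gateConv_relay_row (y q : ℝ) (M₁ : ℕ) (μ₁ ρ : ℕ → ℝ) (hy : 1 / 2 ≤ y) (hy1 : y < 1) (hq0 : 0 < q) (hq1 : q ≤ 1)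
    (h10 : ∀ h, 0 ≤ μ₁ h) (h1M : ∀ h, M₁ < h → μ₁ h = 0) (h11 : ∑ h ∈ Finset.range (M₁ + 1), μ₁ h = 1)
    (h20 : ∀ h, 0 ≤ ρ h) (h21 : ∑ h ∈ Finset.range (1 + 1), ρ h = 1)
    (hta2 : y * ((1 : ℕ) : ℝ) ≤ q * ∑ h ∈ Finset.range (1 + 1), (h : ℝ) * ρ h)
    (hB1 : ∀ c : ℕ, 2 * (c : ℝ) < q * ∑ h ∈ Finset.range (M₁ + 1), (h : ℝ) * μ₁ h →
      y / (1 - y) * ∑ h ∈ Finset.range (c + 1), gate μ₁ q h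
        ≤ ∑ h ∈ Finset.range (M₁ + 1),
          (if q * (∑ h ∈ Finset.range (M₁ + 1), (h : ℝ) * μ₁ h) - (c : ℝ) ≤ (h : ℝ) then gate μ₁ q h else 0))
    (d : ℕ) (hd : 1 ≤ d)
    (hdt : 2 * (d : ℝ) < q * ((∑ h ∈ Finset.range (M₁ + 1), (h : ℝ) * μ₁ h) + ∑ h ∈ Finset.range (1 + 1), (h : ℝ) * ρ h)) :
    y / (1 - y) * ∑ h ∈ Finset.range (d + 1), gate (lconv M₁ 1 μ₁ ρ) q h
      ≤ ∑ h ∈ Finset.range (M₁ + 1 + 1),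
        (if q * ((∑ h ∈ Finset.range (M₁ + 1), (h : ℝ) * μ₁ h) + ∑ h ∈ Finset.range (1 + 1), (h : ℝ) * ρ h) - (d : ℝ) ≤ (h : ℝ)
          then gate (lconv M₁ 1 μ₁ ρ) q h else 0) := by
  set T₁ : ℝ := ∑ h ∈ Finset.range (M₁ + 1), (h : ℝ) * μ₁ h with hT₁
  set L : ℕ → ℝ := lconv M₁ 1 μ₁ ρ with hL
  -- the relay's data
  have hT₂ : ∑ h ∈ Finset.range (1 + 1), (h : ℝ) * ρ h = ρ 1 := by simp [Finset.sum_range_succ]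
  have hρ0 : ρ 0 = 1 - ρ 1 := by
    have : ρ 0 + ρ 1 = 1 := by simpa [Finset.sum_range_succ] using h21
    linarith
  set p : ℝ := ρ 1 with hp_def
  rw [hT₂] at hta2 hdt
  simp only [hT₂]
  have hp1 : p ≤ 1 := by have := h20 0; rw [hρ0] at this; linarith
  have hqp : q * p ≤ 1 := by nlinarith
  have hyp : y ≤ p := by simp only [Nat.cast_one, mul_one] at hta2; nlinarith [h20 1]
  have hp : 1 / 2 ≤ p := le_trans hy hyp
  have hy0 : 0 ≤ y := by linarith
  have h1y : 0 < 1 - y := by linarith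
  -- gated laws vanish above the support
  have hg1 : ∀ h, M₁ < h → gate μ₁ q h = 0 := fun h hh => by
    simp only [gate]; rw [h1M h hh, if_neg (by omega)]; ring
  have hgL : ∀ h, M₁ + 1 < h → gate L q h = 0 := fun h hh => by
    simp only [gate]; rw [hL, lconv_eq_zero M₁ 1 μ₁ ρ h hh, if_neg (by omega)]; ring
  -- hypothesis rows in functional form
  have hrows : ∀ c : ℕ, 2 * (c : ℝ) < q * T₁ → 0 ≤ ∑ a ∈ Finset.range (M₁ + 1), μ₁ a *
      ((1 - y) * q * (if q * T₁ - c ≤ (a : ℝ) then (1 : ℝ) else 0) - y * q * (if a ≤ c then (1 : ℝ) else 0) - y * (1 - q)) := by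
    intro c hc
    have hrow := hB1 c hc
    rw [sum_range_eq_sum_ite_of_vanish (gate μ₁ q) M₁ c hg1, sum_ite_gate, sum_ite_gate] at hrow
    rw [if_pos (Nat.zero_le c), if_neg (by push_cast; linarith : ¬ (q * T₁ - (c : ℝ) ≤ ((0 : ℕ) : ℝ)))] at hrow
    rw [div_mul_eq_mul_div, div_le_iff₀ h1y] at hrow
    have e : ∑ a ∈ Finset.range (M₁ + 1), μ₁ a *
        ((1 - y) * q * (if q * T₁ - c ≤ (a : ℝ) then (1 : ℝ) else 0) - y * q * (if a ≤ c then (1 : ℝ) else 0) - y * (1 - q))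
        = (1 - y) * q * ∑ a ∈ Finset.range (M₁ + 1), (if q * T₁ - c ≤ (a : ℝ) then μ₁ a else 0)
          - y * q * ∑ a ∈ Finset.range (M₁ + 1), (if a ≤ c then μ₁ a else 0) - y * (1 - q) := by
      have s1 : ∑ a ∈ Finset.range (M₁ + 1), μ₁ a * ((1 - y) * q * (if q * T₁ - c ≤ (a : ℝ) then (1 : ℝ) else 0))
          = (1 - y) * q * ∑ a ∈ Finset.range (M₁ + 1), (if q * T₁ - c ≤ (a : ℝ) then μ₁ a else 0) :=
        sum_mul_weighted_ite _ _ _ _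
      have s2 : ∑ a ∈ Finset.range (M₁ + 1), μ₁ a * (y * q * (if a ≤ c then (1 : ℝ) else 0))
          = y * q * ∑ a ∈ Finset.range (M₁ + 1), (if a ≤ c then μ₁ a else 0) :=
        sum_mul_weighted_ite _ _ _ _
      have s3 : ∑ a ∈ Finset.range (M₁ + 1), μ₁ a * (y * (1 - q)) = y * (1 - q) := by
        rw [← Finset.sum_mul, h11, one_mul]
      conv_rhs => rw [← s1, ← s2, ← s3, ← Finset.sum_sub_distrib, ← Finset.sum_sub_distrib]
      exact Finset.sum_congr rfl fun a _ => by ring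
    rw [e]
    nlinarith [hrow]
  -- the functional conclusion
  have main := lconv_relay_row_functional y q (q * T₁) M₁ μ₁ ρ d hy0 hy1.le hq0.le h10 hρ0 hqp hp hp1 hyp hrows hd (by linarith)
  -- convert to the `TLB` shape
  have hmass : ∑ h ∈ Finset.range (M₁ + 1 + 1), L h = 1 := sum_lconv M₁ 1 μ₁ ρ h11 h21
  have ethr : ∀ h : ℕ, (q * (T₁ + p) - (d : ℝ) ≤ (h : ℝ)) ↔ (q * T₁ + q * p - (d : ℝ) ≤ (h : ℝ)) := fun h => by
    constructor <;> intro hh <;> linarith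
  simp only [ethr]
  rw [sum_range_eq_sum_ite_of_vanish (gate L q) (M₁ + 1) d hgL, sum_ite_gate, sum_ite_gate,
    if_pos (Nat.zero_le d), if_neg (by push_cast; linarith : ¬ (q * T₁ + q * p - (d : ℝ) ≤ ((0 : ℕ) : ℝ)))]
  rw [div_mul_eq_mul_div, div_le_iff₀ h1y]
  have e : ∑ h ∈ Finset.range (M₁ + 1 + 1), L h *
      ((1 - y) * q * (if q * T₁ + q * p - d ≤ (h : ℝ) then (1 : ℝ) else 0) - y * q * (if h ≤ d then (1 : ℝ) else 0) - y * (1 - q))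
      = (1 - y) * q * ∑ h ∈ Finset.range (M₁ + 1 + 1), (if q * T₁ + q * p - d ≤ (h : ℝ) then L h else 0)
        - y * q * ∑ h ∈ Finset.range (M₁ + 1 + 1), (if h ≤ d then L h else 0) - y * (1 - q) := by
    have s1 : ∑ h ∈ Finset.range (M₁ + 1 + 1), L h * ((1 - y) * q * (if q * T₁ + q * p - d ≤ (h : ℝ) then (1 : ℝ) else 0))
        = (1 - y) * q * ∑ h ∈ Finset.range (M₁ + 1 + 1), (if q * T₁ + q * p - d ≤ (h : ℝ) then L h else 0) :=
      sum_mul_weighted_ite _ _ _ _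
    have s2 : ∑ h ∈ Finset.range (M₁ + 1 + 1), L h * (y * q * (if h ≤ d then (1 : ℝ) else 0))
        = y * q * ∑ h ∈ Finset.range (M₁ + 1 + 1), (if h ≤ d then L h else 0) :=
      sum_mul_weighted_ite _ _ _ _
    have s3 : ∑ h ∈ Finset.range (M₁ + 1 + 1), L h * (y * (1 - q)) = y * (1 - q) := by
      rw [← Finset.sum_mul, hmass, one_mul]
    conv_rhs => rw [← s1, ← s2, ← s3, ← Finset.sum_sub_distrib, ← Finset.sum_sub_distrib]
    exact Finset.sum_congr rfl fun a _ => by ring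
  rw [e] at main
  nlinarith [main]

end LawDec

end Quant

end Summit.CriticalPhenomena.PercolationContinuityZ3.Theorems
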